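import Summits.RiemannHypothesis.RiemannHypothesis.Theorems.Splittings.ScrewWolffDiscreteDataB

/-!
# Discrete Wolff data («divisor rings») — part C: vanishing moments, discreteness, the packaged theorem

Continuation of `ScrewWolffDiscreteDataA/B` (same namespace).  Main theorem: `exists_discreteWolffData` — for every
`R > 1` a countable positive summable atomic family in `1 < ‖w‖ < R` with ALL holomorphic moments zero, unattained
supremum of moduli, and only finitely many atoms below every `ρ < R` (B16′ input; census V106).  ζ-free, RH-free.
-/

set_option linter.dupNamespace false

namespace Summit.RiemannHypothesis.RiemannHypothesis.Theorems.Splittings.ScrewWolffDiscreteData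

open Complex Finset Filter Topology

noncomputable section

/-! ## 8. Vanishing of all moments -/

/-- The `k`-th power of a ring atom, summed over the ring: `[nM ∣ k]·nM·rad^k·wdir^k`. -/
theorem sum_ring_pow {M : ℕ} (hM : 1 ≤ M) (n : Live) (k : ℕ) :
    ∑ l : Fin (n.1 * M), ((wt M (Sum.inr ⟨n, l⟩) : ℂ) * atom M (Sum.inr ⟨n, l⟩) ^ k)
      = if n.1 * M ∣ k then term (coef n.1) (k / (n.1 * M)) else 0 := by
  have h2 := coef_ne_zero_two_le n.2
  have hn1 : 1 ≤ n.1 := by omega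
  have hnM : n.1 * M ≠ 0 := by positivity
  simp only [wt, atom]
  have : ∀ l : Fin (n.1 * M), ((‖coef n.1‖ / ((n.1 : ℝ) * M) : ℝ) : ℂ) *
      ((rad n.1 M : ℂ) * wdir n.1 M * ω (n.1 * M) ^ (l : ℕ)) ^ k
      = ((‖coef n.1‖ / ((n.1 : ℝ) * M) : ℝ) : ℂ) * ((rad n.1 M : ℂ) ^ k * wdir n.1 M ^ k) *
        (ω (n.1 * M) ^ k) ^ (l : ℕ) := by
    intro l; ring
  rw [Finset.sum_congr rfl (fun l _ ↦ this l), ← Finset.mul_sum, sum_ω_pow hnM]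
  split_ifs with hdvd
  · obtain ⟨m, hm⟩ := hdvd
    rw [hm, Nat.mul_div_cancel_left m (Nat.pos_of_ne_zero hnM),
      show wdir n.1 M ^ (n.1 * M * m) = (wdir n.1 M ^ (n.1 * M)) ^ m from pow_mul _ _ _, wdir_pow hn1 hM,
      ← Complex.ofReal_pow, rad_pow n.1 M m hn1 hM, term]
    have hn0 : (n.1 : ℂ) ≠ 0 := by exact_mod_cast (show n.1 ≠ 0 by omega)
    have hM0 : (M : ℂ) ≠ 0 := by exact_mod_cast (show M ≠ 0 by omega)
    push_cast
    field_simp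
  · simp

/-- The `k`-th powers of the seed atoms sum to `[2M ∣ k]·q^{k/(2M)·2}`… precisely `seedMom (k / M)` when
`M ∣ k`, and `0` otherwise. -/
theorem sum_seed_pow {M : ℕ} (hM : 1 ≤ M) (k : ℕ) :
    ∑ l : Fin (2 * M), ((wt M (Sum.inl l) : ℂ) * atom M (Sum.inl l) ^ k)
      = if 2 * M ∣ k then (q : ℂ) ^ (k / (2 * M) * 2) else 0 := by
  have h2M : 2 * M ≠ 0 := by positivity
  simp only [wt, atom]
  have : ∀ l : Fin (2 * M), (((1 / (2 * (M : ℝ)) : ℝ) : ℂ)) * ((rad 1 M : ℂ) * ω (2 * M) ^ (l : ℕ)) ^ k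
      = (((1 / (2 * (M : ℝ)) : ℝ) : ℂ)) * (rad 1 M : ℂ) ^ k * (ω (2 * M) ^ k) ^ (l : ℕ) := by
    intro l; ring
  rw [Finset.sum_congr rfl (fun l _ ↦ this l), ← Finset.mul_sum, sum_ω_pow h2M]
  split_ifs with hdvd
  · obtain ⟨m, hm⟩ := hdvd
    rw [hm, Nat.mul_div_cancel_left m (Nat.pos_of_ne_zero h2M), ← Complex.ofReal_pow,
      show 2 * M * m = 1 * M * (m * 2) by ring, rad_pow 1 M (m * 2) le_rfl hM]
    have hM0 : (M : ℂ) ≠ 0 := by exact_mod_cast (show M ≠ 0 by omega)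
    push_cast
    field_simp
  · simp

/-- Summability of the moment family (dominated by the weights). -/
theorem summable_moment {M : ℕ} (hM : 1 ≤ M) (k : ℕ) :
    Summable (fun i : Idx M ↦ (wt M i : ℂ) * atom M i ^ k) := by
  refine Summable.of_norm_bounded (summable_wt hM) (fun i ↦ ?_)
  rw [norm_mul, norm_pow, Complex.norm_real, Real.norm_eq_abs, abs_of_pos (wt_pos hM i), norm_atom]
  have h1 : rad (level i) M ^ k ≤ 1 := pow_le_one₀ (rad_pos _ _).le (rad_lt_one (one_le_level i) hM).le
  calc wt M i * rad (level i) M ^ k ≤ wt M i * 1 := by gcongr; exact (wt_pos hM i).le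
    _ = wt M i := mul_one _

/-- **All holomorphic moments vanish**: `Σ_i wt_i · atom_i^k = 0` for every `k ≥ 1`. -/
theorem hasSum_moment {M : ℕ} (hM : 1 ≤ M) {k : ℕ} (hk : 1 ≤ k) :
    HasSum (fun i : Idx M ↦ (wt M i : ℂ) * atom M i ^ k) 0 := by
  have hM0 : M ≠ 0 := by omega
  -- seed part
  have hseed : HasSum ((fun i : Idx M ↦ (wt M i : ℂ) * atom M i ^ k) ∘ Sum.inl)
      (if 2 * M ∣ k then (q : ℂ) ^ (k / (2 * M) * 2) else 0) := by
    rw [← sum_seed_pow hM k]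
    exact hasSum_fintype _
  -- ring part, ring by ring
  set g : Live → ℂ := fun n ↦ if n.1 * M ∣ k then term (coef n.1) (k / (n.1 * M)) else 0 with hg
  have hring : ∀ n : Live, HasSum (fun l : Fin (n.1 * M) ↦
      ((fun i : Idx M ↦ (wt M i : ℂ) * atom M i ^ k) ∘ Sum.inr) ⟨n, l⟩) (g n) := by
    intro n
    simp only [Function.comp, hg]
    rw [← sum_ring_pow hM n k]
    exact hasSum_fintype _
  -- the ring totals are supported on the live divisors of `k / M`
  set D : Finset Live := (Nat.divisors k).subtype (fun n ↦ coef n ≠ 0) with hD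
  have hgsupp : ∀ n : Live, n ∉ D → g n = 0 := by
    intro n hn
    simp only [hg]
    rw [if_neg]
    intro hdvd
    apply hn
    rw [hD, Finset.mem_subtype]
    exact Nat.mem_divisors.2 ⟨dvd_trans (dvd_mul_right n.1 M) hdvd, by omega⟩
  have hgsum : HasSum g (∑ n ∈ D, g n) := hasSum_sum_of_ne_finset_zero hgsupp
  have hinr : HasSum ((fun i : Idx M ↦ (wt M i : ℂ) * atom M i ^ k) ∘ Sum.inr) (∑ n ∈ D, g n) :=
    HasSum.sigma_of_hasSum hgsum hring ((summable_moment hM k).comp_injective Sum.inr_injective)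
  have htot := HasSum.sum hseed hinr
  -- evaluate the total
  suffices hzero : (if 2 * M ∣ k then (q : ℂ) ^ (k / (2 * M) * 2) else 0) + ∑ n ∈ D, g n = 0 by
    rwa [hzero] at htot
  by_cases hMk : M ∣ k
  · obtain ⟨j, rfl⟩ := hMk
    have hj : 1 ≤ j := by
      rcases Nat.eq_zero_or_pos j with h | h
      · subst h; simp at hk
      · exact h
    -- reduce to the base identity at frequency `j`
    have hseedj : (if 2 * M ∣ M * j then (q : ℂ) ^ (M * j / (2 * M) * 2) else 0) = seedMom j := by
      simp only [seedMom]
      have hiff : 2 * M ∣ M * j ↔ 2 ∣ j := by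
        rw [mul_comm 2 M]; exact Nat.mul_dvd_mul_iff_left (Nat.pos_of_ne_zero hM0)
      by_cases h2 : 2 ∣ j
      · rw [if_pos (hiff.2 h2), if_pos h2]
        obtain ⟨i, rfl⟩ := h2
        congr 1
        rw [show M * (2 * i) = 2 * M * i by ring, Nat.mul_div_cancel_left i (by positivity)]
        ring
      · rw [if_neg (fun h ↦ h2 (hiff.1 h)), if_neg h2]
    have hgj : ∀ n : Live, g n = if n.1 ∣ j then term (coef n.1) (j / n.1) else 0 := by
      intro n
      have hn0 : 0 < n.1 := by have := coef_ne_zero_two_le n.2; omega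
      simp only [hg]
      have hiff : n.1 * M ∣ M * j ↔ n.1 ∣ j := by
        rw [mul_comm n.1 M]; exact Nat.mul_dvd_mul_iff_left (Nat.pos_of_ne_zero hM0)
      by_cases h : n.1 ∣ j
      · rw [if_pos (hiff.2 h), if_pos h]
        obtain ⟨i, rfl⟩ := h
        rw [show M * (n.1 * i) = n.1 * M * i by ring, Nat.mul_div_cancel_left i (by positivity),
          Nat.mul_div_cancel_left i hn0]
      · rw [if_neg (fun h' ↦ h (hiff.1 h')), if_neg h]
    rw [hseedj, Finset.sum_congr rfl (fun n _ ↦ hgj n)]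
    -- compare with `seedMom_add_sum_divisors j`: the live divisors of `M j` dividing `j` are the live
    -- divisors of `j`, and dead divisors contribute `term 0 _ = 0`
    have hsub : (Nat.divisors j).filter (fun d ↦ coef d ≠ 0)
        = ((Nat.divisors (M * j)).filter (fun d ↦ coef d ≠ 0)).filter (fun d ↦ d ∣ j) := by
      ext d
      simp only [Finset.mem_filter, Nat.mem_divisors]
      constructor
      · rintro ⟨⟨hdj, hj0⟩, hc⟩
        exact ⟨⟨⟨dvd_trans hdj (dvd_mul_left j M), by positivity⟩, hc⟩, hdj⟩
      · rintro ⟨⟨⟨_, hMj⟩, hc⟩, hdj⟩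
        exact ⟨⟨hdj, by omega⟩, hc⟩
    have hzero : ∑ d ∈ (Nat.divisors j).filter (fun d ↦ ¬ coef d ≠ 0),
        (if 2 ≤ d then term (coef d) (j / d) else 0) = 0 := by
      refine Finset.sum_eq_zero fun d hd ↦ ?_
      have : coef d = 0 := by simpa using (Finset.mem_filter.1 hd).2
      simp [this, term_zero]
    have hsum_eq : ∑ n ∈ D, (if n.1 ∣ j then term (coef n.1) (j / n.1) else 0)
        = ∑ d ∈ Nat.divisors j, (if 2 ≤ d then term (coef d) (j / d) else 0) := by
      rw [hD, Finset.sum_subtype_eq_sum_filter (f := fun d ↦ if d ∣ j then term (coef d) (j / d) else 0),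
        ← Finset.sum_filter, ← hsub,
        ← Finset.sum_filter_add_sum_filter_not (Nat.divisors j) (fun d ↦ coef d ≠ 0)
          (fun d ↦ if 2 ≤ d then term (coef d) (j / d) else 0), hzero, add_zero]
      refine Finset.sum_congr rfl fun d hd ↦ ?_
      rw [if_pos (coef_ne_zero_two_le (Finset.mem_filter.1 hd).2)]
    rw [hsum_eq]
    exact seedMom_add_sum_divisors j hj
  · -- `M ∤ k`: every indicator vanishes
    have h1 : ¬ 2 * M ∣ k := fun h ↦ hMk (dvd_trans (dvd_mul_left M 2) h)
    rw [if_neg h1, zero_add]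
    refine Finset.sum_eq_zero fun n _ ↦ ?_
    simp only [hg]
    rw [if_neg]
    exact fun h ↦ hMk (dvd_trans (dvd_mul_left M n.1) h)

/-! ## 9. Discreteness inside the disc and non-attainment of the supremum -/

/-- Below every radius `ρ < 1` there are only finitely many atoms. -/
theorem finite_norm_le {M : ℕ} (hM : 1 ≤ M) {ρ : ℝ} (hρ : ρ < 1) : {i : Idx M | ‖atom M i‖ ≤ ρ}.Finite := by
  obtain ⟨N, hN1, hN⟩ := exists_rad_gt hρ
  -- atoms of level `n ≥ N` have norm `rad n M ≥ rad N 1 > ρ`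
  have hbig : ∀ i : Idx M, N ≤ level i → ρ < ‖atom M i‖ := by
    intro i hi
    rw [norm_atom]
    refine hN.trans_le ?_
    calc rad N 1 ≤ rad (level i) 1 := rad_le_rad hN1 le_rfl hi
      _ ≤ rad (level i) M := by
          apply Real.rpow_le_rpow_of_exponent_ge q_pos q_lt_one.le
          have : (0 : ℝ) < level i := by exact_mod_cast (one_le_level i)
          have : (1 : ℝ) ≤ M := by exact_mod_cast hM
          gcongr
  rw [← Set.finite_preimage_inl_and_inr]
  constructor
  · exact Set.toFinite _
  · -- ring atoms with `‖atom‖ ≤ ρ` have level `< N` and position `< N*M`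
    have hinj : Set.InjOn (fun x : (Σ n : Live, Fin (n.1 * M)) ↦ ((x.1.1 : ℕ), (x.2 : ℕ))) Set.univ := by
      rintro ⟨n, l⟩ _ ⟨n', l'⟩ _ h
      simp only [Prod.mk.injEq] at h
      obtain ⟨hn, hl⟩ := h
      have hnn : n = n' := Subtype.ext hn
      subst hnn
      have hll : l = l' := Fin.ext hl
      subst hll
      all_goals rfl
    refine ((Finset.range N ×ˢ Finset.range (N * M)).finite_toSet.preimage (hinj.mono
      (Set.subset_univ _))).subset ?_
    rintro ⟨n, l⟩ hx
    simp only [Set.mem_preimage, Set.mem_setOf_eq, Finset.coe_product, Set.mem_prod, Finset.coe_range,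
      Set.mem_Iio] at hx ⊢
    have hlev : n.1 < N := by
      by_contra hge
      exact absurd hx (not_le.mpr (hbig (Sum.inr ⟨n, l⟩) (by simpa [level] using not_lt.mp hge)))
    refine ⟨hlev, ?_⟩
    calc (l : ℕ) < n.1 * M := l.2
      _ ≤ N * M := Nat.mul_le_mul_right M hlev.le

/-- Every atom is beaten in modulus by some other atom (a live ring of larger index). -/
theorem exists_norm_lt {M : ℕ} (hM : 1 ≤ M) (i : Idx M) : ∃ j : Idx M, ‖atom M i‖ < ‖atom M j‖ := by
  obtain ⟨n, hn, hlive⟩ := exists_live_gt (level i)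
  have hn2 := coef_ne_zero_two_le hlive
  refine ⟨Sum.inr ⟨⟨n, hlive⟩, ⟨0, by positivity⟩⟩, ?_⟩
  rw [norm_atom, norm_atom]
  exact rad_lt_rad (one_le_level i) hM (by simpa [level] using hn)

/-! ## 10. The packaged theorem -/

/-- **Discrete Wolff data (B16′ input).**  For every `R > 1` there is a countable family of atoms in the open
annulus `1 < ‖w‖ < R` with positive summable weights, ALL of whose holomorphic moments vanish, whose moduli
have an unattained supremum, and which is DISCRETE in the annulus: below every `ρ < R` lie only finitely many
atoms (they accumulate only on the outer circle `‖w‖ = R`).  Compare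
`ScrewLatticeWolffData.exists_wolffData` (same conclusions without the last one; there the atoms accumulate
on every circle of an Apollonian packing). -/
theorem exists_discreteWolffData {R : ℝ} (hR : 1 < R) :
    ∃ (ι : Type) (_ : Countable ι) (w : ι → ℂ) (α : ι → ℝ),
      Nonempty ι ∧ (∀ i, 1 < ‖w i‖ ∧ ‖w i‖ < R) ∧ (∀ i, 0 < α i) ∧ Summable α ∧
      (∀ k : ℕ, 1 ≤ k → HasSum (fun i ↦ (α i : ℂ) * w i ^ k) 0) ∧
      (∀ i, ∃ j, ‖w i‖ < ‖w j‖) ∧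
      (∀ ρ < R, {i | ‖w i‖ ≤ ρ}.Finite) := by
  have hR0 : 0 < R := by linarith
  have hρ : 1 / R < 1 := by rw [div_lt_one hR0]; exact hR
  obtain ⟨M, hM, hMR⟩ := exists_rad_gt hρ
  refine ⟨Idx M, inferInstance, fun i ↦ (R : ℂ) * atom M i, wt M, ⟨Sum.inl ⟨0, by omega⟩⟩, ?_, wt_pos hM,
    summable_wt hM, ?_, ?_, ?_⟩
  · intro i
    rw [norm_mul, Complex.norm_real, Real.norm_eq_abs, abs_of_pos hR0, norm_atom]
    constructor
    · have h1 : rad M 1 ≤ rad (level i) M := by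
        rw [rad, rad]
        apply Real.rpow_le_rpow_of_exponent_ge q_pos q_lt_one.le
        have : (1 : ℝ) ≤ level i := by exact_mod_cast one_le_level i
        have : (0 : ℝ) < M := by exact_mod_cast hM
        simp only [Nat.cast_one, mul_one]
        rw [one_div_le_one_div (by positivity) (by positivity)]
        nlinarith
      rw [div_lt_iff₀ hR0] at hMR
      calc (1 : ℝ) < rad M 1 * R := hMR
        _ ≤ rad (level i) M * R := by gcongr
        _ = R * rad (level i) M := mul_comm _ _
    · calc R * rad (level i) M < R * 1 := by gcongr; exact rad_lt_one (one_le_level i) hM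
        _ = R := mul_one R
  · intro k hk
    have h := (hasSum_moment hM hk).mul_left ((R : ℂ) ^ k)
    rw [mul_zero] at h
    have hfun : (fun i : Idx M ↦ ((wt M i : ℝ) : ℂ) * ((R : ℂ) * atom M i) ^ k)
        = fun i ↦ (R : ℂ) ^ k * ((wt M i : ℂ) * atom M i ^ k) := by
      funext i; ring
    rw [hfun]
    exact h
  · intro i
    obtain ⟨j, hj⟩ := exists_norm_lt hM i
    refine ⟨j, ?_⟩
    rw [norm_mul, norm_mul]
    gcongr
    rw [Complex.norm_real, Real.norm_eq_abs, abs_of_pos hR0]; exact hR0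
  · intro ρ hρR
    have hρ' : ρ / R < 1 := by rw [div_lt_one hR0]; exact hρR
    refine (finite_norm_le hM hρ').subset fun i hi ↦ ?_
    simp only [Set.mem_setOf_eq] at hi ⊢
    rw [norm_mul, Complex.norm_real, Real.norm_eq_abs, abs_of_pos hR0] at hi
    rw [le_div_iff₀ hR0]; linarith

end

end Summit.RiemannHypothesis.RiemannHypothesis.Theorems.Splittings.ScrewWolffDiscreteData
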